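import Mathlib
import Summits.PneNP.PneNP.Theorems.KarlinRubinMonotoneSufficesStubShiftRatio

/-!
# Crux `MonotoneSuffices` (stmt-PneNP-18026), line `Sketch` — mixture-shift rung, stub S1a:
the collision number of two independent uniform `r`-subsets

The density-shift rung of line `Sketch` replaces an input `x` by the up-shift `x ∨ 1_R` for a
random set `R`; a mixture of such shifts is controlled by the collision number
`E 2^{#(R ∩ R')}` of two independent copies `R, R'` of the random shift set (the chi-square of
the shifted law against the uniform one). This file bounds it for the basic local shift, where
`R, R'` are independent uniformly random `r`-subsets of a slot set `T` with `m = #T` elements: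
`E 2^{#(R ∩ R')} ≤ exp (r² / m)`, stated as the double sum
`∑_{R, R'} 2^{#(R ∩ R')} ≤ C(m,r)² · exp (r²/m)`.

Proof. For a fixed `r`-subset `R ⊆ T`, `2^{#(R ∩ R')} = #{J ⊆ R | J ⊆ R'}`, so exchanging sums
`∑_{R'} 2^{#(R ∩ R')} = ∑_{J ⊆ R} #{R' | J ⊆ R'} ≤ ∑_{J ⊆ R} C(m - #J, r - #J)`
(`R' ↦ R' \ J` lands in the `(r - #J)`-subsets of `T \ J`). The ratio bound
`C(m - j, r - j) ≤ C(m,r) · (r/m)^j` (from `C(m,r) C(r,j) = C(m,j) C(m-j,r-j)` and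
`C(r,j) ≤ C(m,j) (r/m)^j`) and the binomial theorem over `R.powerset` give
`∑_{R'} 2^{#(R ∩ R')} ≤ C(m,r) (1 + r/m)^r ≤ C(m,r) exp (r²/m)`; summing over the `C(m,r)`
choices of `R` finishes.

* `subsetCollision_two_pow_card_inter` — `2^{#(R ∩ R')} = ∑_{J ⊆ R} [J ⊆ R']`;
* `subsetCollision_sum_two_pow_eq` — the exchange of summations;
* `subsetCollision_card_filter_supset_le` — `#{R' ∈ T.powersetCard r | J ⊆ R'} ≤ C(m-#J, r-#J)`;
* `subsetCollision_choose_sub_le` — `C(m-j, r-j) ≤ C(m,r) (r/m)^j` for `j ≤ r ≤ m`;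
* `subsetCollision_sum_powerset_pow_card` — `∑_{J ⊆ R} x^{#J} = (x + 1)^{#R}`;
* `subsetCollision_one_add_pow_le_exp` — `(1 + r/m)^r ≤ exp (r²/m)`;
* `subsetCollision_inner_le` — the bound `C(m,r) exp (r²/m)` for a fixed `R`;
* `stub_subsetCollision` — the registered stub (S1a).
-/

set_option linter.dupNamespace false -- `Summit.PneNP.PneNP.…`: summit = sub-problem name (D-0017)

namespace Summit.PneNP.PneNP.Theorems.MonotoneSuffices.DensityShift

open Finset

/-- **Powerset expansion of the collision weight.** `2^{#(R ∩ R')}` counts the subsets of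
`R ∩ R'`, i.e. the subsets `J ⊆ R` with `J ⊆ R'`. [folklore] -/
theorem subsetCollision_two_pow_card_inter {α : Type*} [DecidableEq α] (R R' : Finset α) :
    (2 : ℝ) ^ #(R ∩ R') = ∑ J ∈ R.powerset, if J ⊆ R' then (1 : ℝ) else 0 := by
  have h : R.powerset.filter (fun J => J ⊆ R') = (R ∩ R').powerset := by
    ext J
    simp only [mem_filter, mem_powerset, subset_inter_iff]
  rw [sum_boole, h, card_powerset]
  norm_cast

/-- **Exchange of summations.** Summing the collision weight over `R'` counts, for each `J ⊆ R`,
the `r`-subsets `R'` of `T` containing `J`. [folklore] -/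
theorem subsetCollision_sum_two_pow_eq {α : Type*} [DecidableEq α] (T R : Finset α) (r : ℕ) :
    ∑ R' ∈ T.powersetCard r, (2 : ℝ) ^ #(R ∩ R') =
      ∑ J ∈ R.powerset, (#((T.powersetCard r).filter fun R' => J ⊆ R') : ℝ) := by
  simp_rw [subsetCollision_two_pow_card_inter]
  rw [sum_comm]
  simp_rw [sum_boole]

/-- **Counting supersets.** The `r`-subsets of `T` containing a fixed `J ⊆ T` inject, via
`R' ↦ R' \ J`, into the `(r - #J)`-subsets of `T \ J`; hence there are at most
`C(#T - #J, r - #J)` of them. [folklore] -/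
theorem subsetCollision_card_filter_supset_le {α : Type*} [DecidableEq α] {T J : Finset α}
    (hJT : J ⊆ T) (r : ℕ) :
    #((T.powersetCard r).filter fun R' => J ⊆ R') ≤ (#T - #J).choose (r - #J) :=
  calc #((T.powersetCard r).filter fun R' => J ⊆ R')
      ≤ #(((T \ J).powersetCard (r - #J)).image fun S => S ∪ J) := by
        refine card_le_card fun R' hR' => ?_
        rw [mem_filter, mem_powersetCard] at hR'
        obtain ⟨⟨hR'T, hcard⟩, hJR'⟩ := hR'
        refine mem_image.2 ⟨R' \ J, ?_, sdiff_union_of_subset hJR'⟩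
        rw [mem_powersetCard, card_sdiff_of_subset hJR', hcard]
        exact ⟨sdiff_subset_sdiff hR'T Subset.rfl, rfl⟩
    _ ≤ #((T \ J).powersetCard (r - #J)) := card_image_le
    _ = (#T - #J).choose (r - #J) := by rw [card_powersetCard, card_sdiff_of_subset hJT]

/-- **Ratio bound.** For `j ≤ r ≤ m` and `0 < m`, `C(m - j, r - j) ≤ C(m,r) · (r/m)^j`:
by `C(m,r) C(r,j) = C(m,j) C(m-j, r-j)` this is `C(r,j) ≤ C(m,j) (r/m)^j`,
i.e. `∏_{i<j} (r-i)/(m-i) ≤ (r/m)^j`. [folklore] -/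
theorem subsetCollision_choose_sub_le {m r j : ℕ} (hjr : j ≤ r) (hrm : r ≤ m) (hm : 0 < m) :
    ((m - j).choose (r - j) : ℝ) ≤ (m.choose r : ℝ) * ((r : ℝ) / m) ^ j := by
  have hmul : (m.choose r : ℝ) * (r.choose j : ℝ) =
      (m.choose j : ℝ) * ((m - j).choose (r - j) : ℝ) := by
    exact_mod_cast Nat.choose_mul (n := m) hjr
  have hpos : (0 : ℝ) < (m.choose j : ℝ) := by exact_mod_cast Nat.choose_pos (hjr.trans hrm)
  refine le_of_mul_le_mul_left ?_ hpos
  calc (m.choose j : ℝ) * ((m - j).choose (r - j) : ℝ)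
      = (m.choose r : ℝ) * (r.choose j : ℝ) := hmul.symm
    _ ≤ (m.choose r : ℝ) * ((m.choose j : ℝ) * ((r : ℝ) / m) ^ j) :=
        mul_le_mul_of_nonneg_left (shiftRatio_cast_choose_le hrm hm j) (by positivity)
    _ = (m.choose j : ℝ) * ((m.choose r : ℝ) * ((r : ℝ) / m) ^ j) := by ring

/-- **Binomial theorem over the powerset.** `∑_{J ⊆ R} x^{#J} = (x + 1)^{#R}`. [folklore] -/
theorem subsetCollision_sum_powerset_pow_card {α : Type*} (R : Finset α) (x : ℝ) :
    ∑ J ∈ R.powerset, x ^ #J = (x + 1) ^ #R := by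
  rw [← Finset.sum_pow_mul_eq_add_pow]
  simp only [one_pow, mul_one]

/-- **Exponential bound.** `(1 + r/m)^r ≤ exp (r²/m)`, from `1 + x ≤ exp x` and
`(exp x)^r = exp (r x)`. [folklore] -/
theorem subsetCollision_one_add_pow_le_exp (m r : ℕ) :
    (1 + (r : ℝ) / m) ^ r ≤ Real.exp ((r : ℝ) ^ 2 / m) := by
  have h1 : 1 + (r : ℝ) / m ≤ Real.exp ((r : ℝ) / m) := by
    have := Real.add_one_le_exp ((r : ℝ) / m)
    linarith
  calc (1 + (r : ℝ) / m) ^ r ≤ (Real.exp ((r : ℝ) / m)) ^ r :=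
        pow_le_pow_left₀ (by positivity) h1 r
    _ = Real.exp ((r : ℝ) ^ 2 / m) := by
        rw [← Real.exp_nat_mul]
        congr 1
        ring

/-- **Collision bound for a fixed `R`.** For an `r`-subset `R` of `T` and `m = #T > 0`,
`∑_{R'} 2^{#(R ∩ R')} ≤ C(m,r) · exp (r²/m)`, the sum running over the `r`-subsets `R'` of `T`:
`∑_{R'} 2^{#(R ∩ R')} ≤ ∑_{J ⊆ R} C(m-#J, r-#J) ≤ C(m,r) ∑_{J ⊆ R} (r/m)^{#J}
 = C(m,r) (1 + r/m)^r ≤ C(m,r) exp (r²/m)`. [folklore] -/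
theorem subsetCollision_inner_le {α : Type*} [DecidableEq α] {T R : Finset α} {r : ℕ}
    (hT : 0 < #T) (hR : R ∈ T.powersetCard r) :
    ∑ R' ∈ T.powersetCard r, (2 : ℝ) ^ #(R ∩ R') ≤
      ((#T).choose r : ℝ) * Real.exp ((r : ℝ) ^ 2 / #T) := by
  rw [mem_powersetCard] at hR
  obtain ⟨hRT, hRcard⟩ := hR
  have hrm : r ≤ #T := hRcard.ge.trans (card_le_card hRT)
  calc ∑ R' ∈ T.powersetCard r, (2 : ℝ) ^ #(R ∩ R')
      = ∑ J ∈ R.powerset, (#((T.powersetCard r).filter fun R' => J ⊆ R') : ℝ) :=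
        subsetCollision_sum_two_pow_eq T R r
    _ ≤ ∑ J ∈ R.powerset, ((#T).choose r : ℝ) * ((r : ℝ) / #T) ^ #J := by
        refine sum_le_sum fun J hJ => ?_
        rw [mem_powerset] at hJ
        have hjr : #J ≤ r := (card_le_card hJ).trans hRcard.le
        calc (#((T.powersetCard r).filter fun R' => J ⊆ R') : ℝ)
            ≤ ((#T - #J).choose (r - #J) : ℝ) := by
              exact_mod_cast subsetCollision_card_filter_supset_le (hJ.trans hRT) r
          _ ≤ ((#T).choose r : ℝ) * ((r : ℝ) / #T) ^ #J :=
              subsetCollision_choose_sub_le hjr hrm hT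
    _ = ((#T).choose r : ℝ) * (1 + (r : ℝ) / #T) ^ r := by
        rw [← mul_sum, subsetCollision_sum_powerset_pow_card, hRcard, add_comm]
    _ ≤ ((#T).choose r : ℝ) * Real.exp ((r : ℝ) ^ 2 / #T) :=
        mul_le_mul_of_nonneg_left (subsetCollision_one_add_pow_le_exp _ _) (by positivity)

/-- **S1a: collision of two independent uniform `r`-subsets of `T`.** With `m = #T > 0`,
`∑_{R, R' ∈ T.powersetCard r} 2^{#(R ∩ R')} ≤ C(m,r)² · exp (r²/m)`, i.e.
`E 2^{#(R ∩ R')} ≤ exp (r²/m)` for independent uniform `r`-subsets `R, R'` of `T`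
(for `r > m` the left-hand side is an empty sum). Sum `subsetCollision_inner_le` over the
`C(m,r)` choices of `R`. [folklore] -/
theorem stub_subsetCollision :
    ∀ {α : Type*} [DecidableEq α] (T : Finset α) (r : ℕ), 0 < #T →
      (∑ R ∈ T.powersetCard r, ∑ R' ∈ T.powersetCard r, (2 : ℝ) ^ #(R ∩ R')) ≤
        ((#T).choose r : ℝ) ^ 2 * Real.exp ((r : ℝ) ^ 2 / #T) := by
  intro α _ T r hT
  calc ∑ R ∈ T.powersetCard r, ∑ R' ∈ T.powersetCard r, (2 : ℝ) ^ #(R ∩ R')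
      ≤ ∑ R ∈ T.powersetCard r, ((#T).choose r : ℝ) * Real.exp ((r : ℝ) ^ 2 / #T) :=
        sum_le_sum fun R hR => subsetCollision_inner_le hT hR
    _ = ((#T).choose r : ℝ) ^ 2 * Real.exp ((r : ℝ) ^ 2 / #T) := by
        rw [sum_const, card_powersetCard, nsmul_eq_mul]
        ring

end Summit.PneNP.PneNP.Theorems.MonotoneSuffices.DensityShift
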